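import Summits.AnomalousDissipation.AnomalousDissipation.Theorems.SawtoothPulseCascadeK1LocalisedCascadeSlotLemmaTools

/-!
# K1loc, line `Spectral` / SeqCone — THE SLOT LEMMA (S3b): symbol energies of the localised Lagrangian pull-back
# of a classical scalar are almost non-increasing across a shear half-slot, κ- and frequency-uniformly

Sixth S3b file of the prover lane on the crux `K1LocalisedCascade` (stmt-AnomalousDissipation-19491), route
`SawtoothPulseCascade` (architecture note `K1loc-architecture-findings-k1locp1.md`, F-b "viscous bookkeeping is
κ-uniform without restart blocks").  Setting on `𝕋²`, `i ≠ j`: a classical solution `θ` of `∂ₜθ + u·∇θ = κΔθ` on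
`[t₀,t₁]` (`Torus.IsClassicalScalarTransportOn`) driven by the shear `u(t) = ShearStage.drift i j φ (ρ t)` (on an H
half-slot of the cascade this is `SawtoothCascade.CascadeParams.field_eq_of_mem_H`); the accumulated shear `Γ`
(`Γ' = ρ` within `[t₀,t₁]`, smooth, `|Γ| ≤ γ`); the Lagrangian pull-back `G = ShearStage.moved θ i j φ (−Γ)`; a smooth
cut-off profile `X` (`|X| ≤ 1`, `|X'| ≤ C₁`, `|X''| ≤ C₂`) to strips on which the slope is `ε₁`-close to `σ`
(`X ≠ 0 ∨ X' ≠ 0 → |φ' − σ| ≤ ε₁`); the localised field `F(t) = X(x_j)·G(t)`; weights `0 ≤ w ≤ 1` on `ℤ²`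
(`w = μ²` for a symbol `0 ≤ μ ≤ 1`).  THE SLOT LEMMA (`sqrt_symbolEnergy_le`, finite sets of modes):

  `√(∑_{k∈S} w(k)|𝓕F(t₁)(k)|²) ≤ √(∑_{k∈S} w(k)|𝓕F(t₀)(k)|²) + E · ‖θ(t₀)‖_{L²}`,
  `E = 2κτC₂ + 4C₁√(κτ/2) + √(γε₁ (5 + 6C₁²κτ))`,  `τ = t₁ − t₀`  (when `γε₁ ≤ 1`),

i.e. (diffusion length / cut-off width) + its square + the slope residual — no dependence on the frequency weights,
none on the energy actually dissipated in the slot.  Ingredients: `d/dt ∑ w|𝓕F|² = 2κ·pairing`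
(`…SlotEvolution`), `pairing ≤ √(∑ w|𝓕F|²)·A(t) + R₀(t)` (`…SlotPairing`), the elementary comparison lemma
`sqrt_le_of_hasDerivWithinAt_le` of `…SlotLemmaTools` (`√q(t₁) ≤ √q(t₀) + 2κ∫A + √(2κ∫R₀)`), and the energy budget
`κ∫(‖∂ᵢG‖² + ‖D̄G‖²) ≤ ½‖θ(t₀)‖²` (`…SlotEvolution.energy_budget_pullback`).
WHAT THIS IS NOT: no statement about the cascade or the stub itself (the instantiation to the cascade's H/V half-slots
and the un-gauging step `θ(t₁) = G(t₁) ∘ Φ_{t₁}⁻¹` — two-branch bookkeeping of the landed S3a layer — are the next files);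
no definitions.
[cite: BedrossianCotiZelati2017, §2 (advection–diffusion by a shear in shear coordinates; k-by-k energy estimates)]
[cite: DEIJ2022, (1.2)–(1.3) (energy identity)] [problem: turb]
-/

-- `Summit.<Summit>.<Problem>`: single-conjunct summit, the duplicate namespace segment is deliberate.
set_option linter.dupNamespace false

noncomputable section

namespace Summit.AnomalousDissipation.AnomalousDissipation.Theorems.SawtoothPulseCascade.K1Slot

open MeasureTheory Set Filter Topology UnitAddTorus Function
open scoped ContDiff InnerProductSpace
open Literature.Analysis Literature.Analysis.FunctionSpaces Literature.Analysis.FunctionSpaces.Torus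
open Literature.Analysis.FluidPDE.ShearStage

-- BODY

section Main

open scoped ComplexConjugate

variable {i j : Fin 2}

-- the assembly is one long estimate chain; the extra heartbeats go to elaborating the large integral terms
set_option maxHeartbeats 400000 in
/-- **THE SLOT LEMMA (finite sets of modes).**  Setting on `𝕋²`, `i ≠ j`: a classical solution `θ` of
`∂ₜθ + u·∇θ = κΔθ` on `[t₀,t₁]` with the shear velocity `u(t) = ShearStage.drift i j φ (ρ t)`; the accumulated shear
`Γ` (`Γ' = ρ` within `[t₀,t₁]`, smooth, `|Γ| ≤ γ`); the pull-back `G = ShearStage.moved θ i j φ (−Γ)`; a cut-off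
profile `X` with `Xd = X'`, `|X| ≤ 1`, `|X'| ≤ C₁`, `|X''| ≤ C₂`, and the flat-strip hypothesis
`X ≠ 0 ∨ X' ≠ 0 → |φ' − σ| ≤ ε₁` (`Q = φ'`), `γε₁ ≤ 1`; the localised field `F(t) = X(x_j)·G(t)`; a finite set of
modes `S` and weights `0 ≤ w ≤ 1`.  Then, with `τ = t₁ − t₀` and `‖θ(t₀)‖ = √(scalarL2Sq (θ t₀))`,
`√(∑_{k∈S} w|𝓕F(t₁)|²) ≤ √(∑_{k∈S} w|𝓕F(t₀)|²) + (2κτC₂ + 4C₁√(κτ/2) + √(γε₁(5 + 6C₁²κτ)))·‖θ(t₀)‖`.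
[cite: BedrossianCotiZelati2017, §2 (energy method in shear coordinates, mode by mode)] -/
theorem sqrt_symbolEnergy_le (hij : i ≠ j) (P Q X Xd : ShearProfile) (hQ : ∀ y, Q y = deriv P y)
    (hXd : ∀ y, Xd y = deriv X y) {Γ ρ : ℝ → ℝ} {t₀ t₁ κ γ σ ε₁ C₁ C₂ : ℝ} (ht : t₀ < t₁) (hκ : 0 ≤ κ)
    (hε₁ : 0 ≤ ε₁) (hγε : γ * ε₁ ≤ 1) (hX1 : ∀ y, |X y| ≤ 1) (hC₁ : ∀ y, |Xd y| ≤ C₁)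
    (hC₂ : ∀ y, |deriv Xd y| ≤ C₂) (hflat : ∀ y, X y ≠ 0 ∨ Xd y ≠ 0 → |Q y - σ| ≤ ε₁)
    {u : ℝ → UnitAddTorus (Fin 2) → EuclideanSpace ℝ (Fin 2)} {θ : ℝ → UnitAddTorus (Fin 2) → ℝ}
    (hθ : FluidPDE.Torus.IsClassicalScalarTransportOn (Icc t₀ t₁) κ u θ)
    (hu : ∀ t ∈ Icc t₀ t₁, u t = drift i j P (ρ t)) (hΓs : ContDiffOn ℝ ∞ Γ (Icc t₀ t₁))
    (hΓρ : ∀ t ∈ Icc t₀ t₁, HasDerivWithinAt Γ (ρ t) (Icc t₀ t₁) t) (hΓγ : ∀ t ∈ Icc t₀ t₁, |Γ t| ≤ γ)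
    (S : Finset (Fin 2 → ℤ)) {w : (Fin 2 → ℤ) → ℝ} (hw0 : ∀ k, 0 ≤ w k) (hw1 : ∀ k, w k ≤ 1) :
    Real.sqrt (∑ k ∈ S, w k * ‖mFourierCoeff (fun x => ((X.onCircle (x j) * moved θ i j P (-Γ) t₁ x : ℝ) : ℂ)) k‖ ^ 2)
      ≤ Real.sqrt (∑ k ∈ S, w k *
          ‖mFourierCoeff (fun x => ((X.onCircle (x j) * moved θ i j P (-Γ) t₀ x : ℝ) : ℂ)) k‖ ^ 2) +
        (2 * κ * (t₁ - t₀) * C₂ + 4 * C₁ * Real.sqrt (κ * (t₁ - t₀) / 2) +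
          Real.sqrt (γ * ε₁ * (5 + 6 * C₁ ^ 2 * κ * (t₁ - t₀)))) * Real.sqrt (FluidPDE.Torus.scalarL2Sq (θ t₀)) := by
  have hU : UniqueDiffOn ℝ (Icc t₀ t₁) := uniqueDiffOn_Icc ht
  have hconv : Convex ℝ (Icc t₀ t₁) := convex_Icc t₀ t₁
  have hτ0 : 0 ≤ t₁ - t₀ := by linarith
  have hC₁0 : 0 ≤ C₁ := (abs_nonneg _).trans (hC₁ 0)
  have hC₂0 : 0 ≤ C₂ := (abs_nonneg _).trans (hC₂ 0)
  have hγ0 : 0 ≤ γ := (abs_nonneg _).trans (hΓγ t₀ (left_mem_Icc.2 ht.le))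
  -- the smooth space–time objects
  have hG : IsSmoothSpaceTimeOn (Icc t₀ t₁) (moved θ i j P (-Γ)) :=
    isSmoothSpaceTimeOn_moved_of_contDiffOn i j P hΓs hθ.smooth_scalar
  have hGt : ∀ t ∈ Icc t₀ t₁, IsSmooth (moved θ i j P (-Γ) t) := fun t htI => hG.isSmooth_slice htI
  have hDG : IsSmoothSpaceTimeOn (Icc t₀ t₁) (fun t x => partialDeriv j (moved θ i j P (-Γ) t) x -
      Γ t * Q.onCircle (x j) * partialDeriv i (moved θ i j P (-Γ) t) x) := isSmoothSpaceTimeOn_slotDeriv hU Q hΓs hG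
  have hDiG : IsSmoothSpaceTimeOn (Icc t₀ t₁) (fun t => partialDeriv i (moved θ i j P (-Γ) t)) := hG.partialDeriv hU i
  -- the three `L²` quantities of `G` and their continuity
  have hNGc : ContinuousOn (fun t => ∫ x, moved θ i j P (-Γ) t x ^ 2) (Icc t₀ t₁) := continuousOn_integral_sq hconv hG
  have hNdc : ContinuousOn (fun t => ∫ x, (partialDeriv j (moved θ i j P (-Γ) t) x -
      Γ t * Q.onCircle (x j) * partialDeriv i (moved θ i j P (-Γ) t) x) ^ 2) (Icc t₀ t₁) :=
    continuousOn_integral_sq hconv hDG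
  have hNic : ContinuousOn (fun t => ∫ x, partialDeriv i (moved θ i j P (-Γ) t) x ^ 2) (Icc t₀ t₁) :=
    continuousOn_integral_sq hconv hDiG
  -- Step 1: the derivative of `q`
  have hqd := fun t (htI : t ∈ Icc t₀ t₁) =>
    hasDerivWithinAt_symbolEnergy hij P X ht hθ hu hΓs htI (hΓρ t htI) S w
  -- Step 2: the differential inequality `q' ≤ 2κ(√q · A + R)`
  have hb : ∀ t ∈ Icc t₀ t₁, 2 * κ * (∑ k ∈ S, (w k : ℂ) *
        conj (mFourierCoeff (fun x => ((X.onCircle (x j) * moved θ i j P (-Γ) t x : ℝ) : ℂ)) k) *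
        mFourierCoeff (fun x => ((X.onCircle (x j) *
          laplacian (θ t) (moved (fun _ y => y) i j P (-Γ) t x) : ℝ) : ℂ)) k).re ≤
      2 * κ * (Real.sqrt (∑ k ∈ S, w k *
          ‖mFourierCoeff (fun x => ((X.onCircle (x j) * moved θ i j P (-Γ) t x : ℝ) : ℂ)) k‖ ^ 2) *
        (C₂ * Real.sqrt (∫ x, moved θ i j P (-Γ) t x ^ 2) +
          2 * C₁ * Real.sqrt (∫ x, (partialDeriv j (moved θ i j P (-Γ) t) x -
            Γ t * Q.onCircle (x j) * partialDeriv i (moved θ i j P (-Γ) t) x) ^ 2)) +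
        γ * ε₁ * (5 * (∫ x, partialDeriv i (moved θ i j P (-Γ) t) x ^ 2) +
          3 * (∫ x, (partialDeriv j (moved θ i j P (-Γ) t) x -
            Γ t * Q.onCircle (x j) * partialDeriv i (moved θ i j P (-Γ) t) x) ^ 2) +
          3 * C₁ ^ 2 * ∫ x, moved θ i j P (-Γ) t x ^ 2)) := by
    intro t htI
    have hp := re_sum_pairing_le hij P Q X Xd hQ hXd (c := Γ t) (σ := σ) hε₁ hC₁ hC₂ hflat
      (hθ.smooth_scalar.isSmooth_slice htI) (moved_neg_apply θ P Γ t)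
      (rfl : (fun x => X.onCircle (x j) * moved θ i j P (-Γ) t x) = _) S hw0 hw1
    obtain ⟨hl1, hl2⟩ := integral_loc_sq_le hij Q X Xd hXd (c := Γ t) (σ := σ) hε₁ (hΓγ t htI) hX1 hC₁ hflat (hGt t htI)
    -- names for the nonnegative quantities
    set Ni := ∫ x, partialDeriv i (moved θ i j P (-Γ) t) x ^ 2 with hNi
    set Nd := ∫ x, (partialDeriv j (moved θ i j P (-Γ) t) x -
      Γ t * Q.onCircle (x j) * partialDeriv i (moved θ i j P (-Γ) t) x) ^ 2 with hNd
    set NG := ∫ x, moved θ i j P (-Γ) t x ^ 2 with hNG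
    set NiF := ∫ x, partialDeriv i (fun x => X.onCircle (x j) * moved θ i j P (-Γ) t x) x ^ 2 with hNiF
    set a := Real.sqrt NiF with ha
    set b := Real.sqrt (∫ x, (partialDeriv j (fun x => X.onCircle (x j) * moved θ i j P (-Γ) t x) x -
      Γ t * σ * partialDeriv i (fun x => X.onCircle (x j) * moved θ i j P (-Γ) t x) x) ^ 2) with hb'
    have hNi0 : 0 ≤ Ni := integral_nonneg fun x => sq_nonneg _
    have hNd0 : 0 ≤ Nd := integral_nonneg fun x => sq_nonneg _
    have hNG0 : 0 ≤ NG := integral_nonneg fun x => sq_nonneg _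
    have hNiF0 : 0 ≤ NiF := integral_nonneg fun x => sq_nonneg _
    have ha0 : 0 ≤ a := Real.sqrt_nonneg _
    have hb0 : 0 ≤ b := Real.sqrt_nonneg _
    have ha2 : a ^ 2 = NiF := by rw [ha, Real.sq_sqrt hNiF0]
    have hb2 : b ^ 2 ≤ 3 * (Nd + C₁ ^ 2 * NG + γ ^ 2 * ε₁ ^ 2 * Ni) := by
      rw [hb', Real.sq_sqrt (integral_nonneg fun x => sq_nonneg _)]; exact hl2
    have hcγ := hΓγ t htI
    have hγε0 : 0 ≤ γ * ε₁ := mul_nonneg hγ0 hε₁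
    have hΓε : |Γ t| * ε₁ ≤ γ * ε₁ := mul_le_mul_of_nonneg_right hcγ hε₁
    have hΓ2 : Γ t ^ 2 * ε₁ ^ 2 ≤ γ * ε₁ := by
      have e1 : Γ t ^ 2 ≤ γ ^ 2 := by rw [← sq_abs]; exact pow_le_pow_left₀ (abs_nonneg _) hcγ 2
      calc Γ t ^ 2 * ε₁ ^ 2 ≤ γ ^ 2 * ε₁ ^ 2 := mul_le_mul_of_nonneg_right e1 (sq_nonneg _)
        _ = (γ * ε₁) * (γ * ε₁) := by ring
        _ ≤ (γ * ε₁) * 1 := mul_le_mul_of_nonneg_left hγε hγε0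
        _ = γ * ε₁ := mul_one _
    have hγ2ε2 : γ ^ 2 * ε₁ ^ 2 ≤ 1 := by nlinarith
    have hR : 2 * |Γ t| * ε₁ * a * b + Γ t ^ 2 * ε₁ ^ 2 * NiF ≤
        γ * ε₁ * (5 * Ni + 3 * Nd + 3 * C₁ ^ 2 * NG) := by
      have h1 : 2 * |Γ t| * ε₁ * a * b ≤ γ * ε₁ * (a ^ 2 + b ^ 2) := by
        have hab : 2 * a * b ≤ a ^ 2 + b ^ 2 := by nlinarith [sq_nonneg (a - b)]
        have h2ab : 0 ≤ 2 * a * b := by positivity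
        calc 2 * |Γ t| * ε₁ * a * b = (|Γ t| * ε₁) * (2 * a * b) := by ring
          _ ≤ (γ * ε₁) * (a ^ 2 + b ^ 2) := mul_le_mul hΓε hab h2ab hγε0
      have h2 : Γ t ^ 2 * ε₁ ^ 2 * NiF ≤ γ * ε₁ * NiF := mul_le_mul_of_nonneg_right hΓ2 hNiF0
      have h3 : γ * ε₁ * (a ^ 2 + b ^ 2) + γ * ε₁ * NiF ≤ γ * ε₁ * (5 * Ni + 3 * Nd + 3 * C₁ ^ 2 * NG) := by
        rw [← mul_add]
        refine mul_le_mul_of_nonneg_left ?_ hγε0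
        have : γ ^ 2 * ε₁ ^ 2 * Ni ≤ Ni := by nlinarith
        nlinarith
      linarith
    have hfin := hp.trans (by linarith [hR] :
      Real.sqrt (∑ k ∈ S, w k * ‖mFourierCoeff (fun x =>
          ((X.onCircle (x j) * moved θ i j P (-Γ) t x : ℝ) : ℂ)) k‖ ^ 2) *
        (C₂ * Real.sqrt NG + 2 * C₁ * Real.sqrt Nd) + 2 * |Γ t| * ε₁ * a * b + Γ t ^ 2 * ε₁ ^ 2 * NiF ≤
      Real.sqrt (∑ k ∈ S, w k * ‖mFourierCoeff (fun x =>
          ((X.onCircle (x j) * moved θ i j P (-Γ) t x : ℝ) : ℂ)) k‖ ^ 2) *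
        (C₂ * Real.sqrt NG + 2 * C₁ * Real.sqrt Nd) + γ * ε₁ * (5 * Ni + 3 * Nd + 3 * C₁ ^ 2 * NG))
    exact mul_le_mul_of_nonneg_left hfin (by positivity : (0 : ℝ) ≤ 2 * κ)
  -- Step 3: continuity of `q'`, `A`, `R` on the slot
  have hII : ∀ {g : ℝ → ℝ}, ContinuousOn g (Icc t₀ t₁) → IntervalIntegrable g volume t₀ t₁ := fun hg =>
    (hg.mono (by rw [uIcc_of_le ht.le])).intervalIntegrable
  have hck : ∀ k : Fin 2 → ℤ, ContinuousOn
      (fun t => mFourierCoeff (fun x => ((X.onCircle (x j) * moved θ i j P (-Γ) t x : ℝ) : ℂ)) k) (Icc t₀ t₁) :=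
    fun k t htI => (hasDerivWithinAt_mFourierCoeff_loc hij P X ht hθ hu hΓs htI (hΓρ t htI) k).continuousWithinAt
  have hLapst : IsSmoothSpaceTimeOn (Icc t₀ t₁)
      (fun t x => X.onCircle (x j) * laplacian (θ t) (moved (fun _ y => y) i j P (-Γ) t x)) :=
    isSmoothSpaceTimeOn_loc X (isSmoothSpaceTimeOn_moved_of_contDiffOn i j P hΓs (hθ.smooth_scalar.laplacian hU))
  have hdk : ∀ k : Fin 2 → ℤ, ContinuousOn (fun t => mFourierCoeff (fun x => ((X.onCircle (x j) *
      laplacian (θ t) (moved (fun _ y => y) i j P (-Γ) t x) : ℝ) : ℂ)) k) (Icc t₀ t₁) := by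
    intro k
    refine ((isSmoothSpaceTimeOn_mFourier_smul hLapst k).continuousOn_integral hconv).congr fun t _ => ?_
    rw [mFourierCoeff_eq_integral_volume]
    simp only [smul_eq_mul]
  have hq'c : ContinuousOn (fun t => 2 * κ * (∑ k ∈ S, (w k : ℂ) *
      conj (mFourierCoeff (fun x => ((X.onCircle (x j) * moved θ i j P (-Γ) t x : ℝ) : ℂ)) k) *
      mFourierCoeff (fun x => ((X.onCircle (x j) *
        laplacian (θ t) (moved (fun _ y => y) i j P (-Γ) t x) : ℝ) : ℂ)) k).re) (Icc t₀ t₁) := by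
    refine continuousOn_const.mul (Complex.continuous_re.comp_continuousOn (continuousOn_finsetSum S
      fun k _ => ?_))
    exact (continuousOn_const.mul (Complex.continuous_conj.comp_continuousOn (hck k))).mul (hdk k)
  have hAc : ContinuousOn (fun t => C₂ * Real.sqrt (∫ x, moved θ i j P (-Γ) t x ^ 2) +
      2 * C₁ * Real.sqrt (∫ x, (partialDeriv j (moved θ i j P (-Γ) t) x -
        Γ t * Q.onCircle (x j) * partialDeriv i (moved θ i j P (-Γ) t) x) ^ 2)) (Icc t₀ t₁) :=
    (continuousOn_const.mul (Real.continuous_sqrt.comp_continuousOn hNGc)).add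
      (continuousOn_const.mul (Real.continuous_sqrt.comp_continuousOn hNdc))
  have hRc : ContinuousOn (fun t => γ * ε₁ * (5 * (∫ x, partialDeriv i (moved θ i j P (-Γ) t) x ^ 2) +
      3 * (∫ x, (partialDeriv j (moved θ i j P (-Γ) t) x -
        Γ t * Q.onCircle (x j) * partialDeriv i (moved θ i j P (-Γ) t) x) ^ 2) +
      3 * C₁ ^ 2 * ∫ x, moved θ i j P (-Γ) t x ^ 2)) (Icc t₀ t₁) :=
    continuousOn_const.mul (((continuousOn_const.mul hNic).add (continuousOn_const.mul hNdc)).add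
      (continuousOn_const.mul hNGc))
  have hA0 : ∀ t ∈ Icc t₀ t₁, 0 ≤ C₂ * Real.sqrt (∫ x, moved θ i j P (-Γ) t x ^ 2) +
      2 * C₁ * Real.sqrt (∫ x, (partialDeriv j (moved θ i j P (-Γ) t) x -
        Γ t * Q.onCircle (x j) * partialDeriv i (moved θ i j P (-Γ) t) x) ^ 2) := fun t _ => by positivity
  have hR0 : ∀ t ∈ Icc t₀ t₁, 0 ≤ γ * ε₁ * (5 * (∫ x, partialDeriv i (moved θ i j P (-Γ) t) x ^ 2) +
      3 * (∫ x, (partialDeriv j (moved θ i j P (-Γ) t) x -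
        Γ t * Q.onCircle (x j) * partialDeriv i (moved θ i j P (-Γ) t) x) ^ 2) +
      3 * C₁ ^ 2 * ∫ x, moved θ i j P (-Γ) t x ^ 2) := fun t _ =>
    mul_nonneg (mul_nonneg hγ0 hε₁) (add_nonneg (add_nonneg (mul_nonneg (by norm_num)
      (integral_nonneg fun x => sq_nonneg _)) (mul_nonneg (by norm_num) (integral_nonneg fun x => sq_nonneg _)))
      (mul_nonneg (by positivity) (integral_nonneg fun x => sq_nonneg _)))
  have hq0 : ∀ t ∈ Icc t₀ t₁, 0 ≤ ∑ k ∈ S, w k *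
      ‖mFourierCoeff (fun x => ((X.onCircle (x j) * moved θ i j P (-Γ) t x : ℝ) : ℂ)) k‖ ^ 2 :=
    fun t _ => Finset.sum_nonneg fun k _ => mul_nonneg (hw0 k) (sq_nonneg _)
  -- Step 4: the comparison lemma
  have hmain := sqrt_le_of_hasDerivWithinAt_le ht.le hκ hqd hq'c hq0 hb hAc hRc hA0 hR0
  -- Step 5: the energy budget bounds the two integrals
  set f2 := FluidPDE.Torus.scalarL2Sq (θ t₀) with hf2
  have hf20 : 0 ≤ f2 := FluidPDE.Torus.scalarL2Sq_nonneg _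
  set nf := Real.sqrt f2 with hnf
  have hnf0 : 0 ≤ nf := Real.sqrt_nonneg _
  have hNGle : ∀ t ∈ Icc t₀ t₁, ∫ x, moved θ i j P (-Γ) t x ^ 2 ≤ f2 := fun t htI => by
    rw [integral_moved_sq_eq hij θ P Γ t, hf2]
    exact FluidPDE.Torus.IsClassicalScalarTransportOn.antitoneOn_scalarL2Sq hθ hκ subset_rfl
      (left_mem_Icc.2 ht.le) htI htI.1
  have hEn := energy_budget_pullback hij P Q hQ Γ ht.le hθ
  have hEn' : κ * ∫ t in t₀..t₁, ((∫ x, partialDeriv i (moved θ i j P (-Γ) t) x ^ 2) +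
      ∫ x, (partialDeriv j (moved θ i j P (-Γ) t) x -
        Γ t * Q.onCircle (x j) * partialDeriv i (moved θ i j P (-Γ) t) x) ^ 2) ≤ f2 / 2 := by
    rw [hEn]; linarith [FluidPDE.Torus.scalarL2Sq_nonneg (θ t₁)]
  have iNN : IntervalIntegrable (fun t => (∫ x, partialDeriv i (moved θ i j P (-Γ) t) x ^ 2) +
      ∫ x, (partialDeriv j (moved θ i j P (-Γ) t) x -
        Γ t * Q.onCircle (x j) * partialDeriv i (moved θ i j P (-Γ) t) x) ^ 2) volume t₀ t₁ := hII (hNic.add hNdc)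
  -- (b3) `∫ √NG ≤ τ nf`
  have hb3 : ∫ t in t₀..t₁, Real.sqrt (∫ x, moved θ i j P (-Γ) t x ^ 2) ≤ (t₁ - t₀) * nf := by
    have h := intervalIntegral.integral_mono_on ht.le (hII (Real.continuous_sqrt.comp_continuousOn hNGc))
      (intervalIntegrable_const (c := nf)) fun t htI => Real.sqrt_le_sqrt (hNGle t htI)
    rwa [intervalIntegral.integral_const, smul_eq_mul] at h
  -- (b4) `κ ∫ √Nd ≤ √(κ τ / 2) nf`
  have hb4 : κ * ∫ t in t₀..t₁, Real.sqrt (∫ x, (partialDeriv j (moved θ i j P (-Γ) t) x -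
      Γ t * Q.onCircle (x j) * partialDeriv i (moved θ i j P (-Γ) t) x) ^ 2) ≤
      Real.sqrt (κ * (t₁ - t₀) / 2) * nf := by
    have hsq := sq_intervalIntegral_le ht.le (Real.continuous_sqrt.comp_continuousOn hNdc)
    have hsq' : ∫ t in t₀..t₁, Real.sqrt (∫ x, (partialDeriv j (moved θ i j P (-Γ) t) x -
        Γ t * Q.onCircle (x j) * partialDeriv i (moved θ i j P (-Γ) t) x) ^ 2) ^ 2 =
        ∫ t in t₀..t₁, ∫ x, (partialDeriv j (moved θ i j P (-Γ) t) x -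
          Γ t * Q.onCircle (x j) * partialDeriv i (moved θ i j P (-Γ) t) x) ^ 2 :=
      intervalIntegral.integral_congr fun t _ => Real.sq_sqrt (integral_nonneg fun x => sq_nonneg _)
    simp only [Function.comp_def] at hsq
    rw [hsq'] at hsq
    have hNd_le : κ * ∫ t in t₀..t₁, ∫ x, (partialDeriv j (moved θ i j P (-Γ) t) x -
        Γ t * Q.onCircle (x j) * partialDeriv i (moved θ i j P (-Γ) t) x) ^ 2 ≤ f2 / 2 := by
      refine le_trans (mul_le_mul_of_nonneg_left (intervalIntegral.integral_mono_on ht.le (hII hNdc)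
        iNN fun t _ => ?_) hκ) hEn'
      have h0 : 0 ≤ ∫ x, partialDeriv i (moved θ i j P (-Γ) t) x ^ 2 := integral_nonneg fun x => sq_nonneg _
      linarith
    have hI0 : 0 ≤ ∫ t in t₀..t₁, Real.sqrt (∫ x, (partialDeriv j (moved θ i j P (-Γ) t) x -
        Γ t * Q.onCircle (x j) * partialDeriv i (moved θ i j P (-Γ) t) x) ^ 2) :=
      intervalIntegral.integral_nonneg ht.le fun t _ => Real.sqrt_nonneg _
    have hkI0 : 0 ≤ κ * ∫ t in t₀..t₁, Real.sqrt (∫ x, (partialDeriv j (moved θ i j P (-Γ) t) x -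
        Γ t * Q.onCircle (x j) * partialDeriv i (moved θ i j P (-Γ) t) x) ^ 2) := mul_nonneg hκ hI0
    have hsq2 : (κ * ∫ t in t₀..t₁, Real.sqrt (∫ x, (partialDeriv j (moved θ i j P (-Γ) t) x -
        Γ t * Q.onCircle (x j) * partialDeriv i (moved θ i j P (-Γ) t) x) ^ 2)) ^ 2 ≤
        κ * (t₁ - t₀) / 2 * f2 := by
      rw [mul_pow]
      calc κ ^ 2 * (∫ t in t₀..t₁, Real.sqrt (∫ x, (partialDeriv j (moved θ i j P (-Γ) t) x -
              Γ t * Q.onCircle (x j) * partialDeriv i (moved θ i j P (-Γ) t) x) ^ 2)) ^ 2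
          ≤ κ ^ 2 * ((t₁ - t₀) * ∫ t in t₀..t₁, ∫ x, (partialDeriv j (moved θ i j P (-Γ) t) x -
              Γ t * Q.onCircle (x j) * partialDeriv i (moved θ i j P (-Γ) t) x) ^ 2) :=
            mul_le_mul_of_nonneg_left hsq (sq_nonneg _)
        _ = κ * (t₁ - t₀) * (κ * ∫ t in t₀..t₁, ∫ x, (partialDeriv j (moved θ i j P (-Γ) t) x -
              Γ t * Q.onCircle (x j) * partialDeriv i (moved θ i j P (-Γ) t) x) ^ 2) := by ring
        _ ≤ κ * (t₁ - t₀) * (f2 / 2) := mul_le_mul_of_nonneg_left hNd_le (mul_nonneg hκ hτ0)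
        _ = κ * (t₁ - t₀) / 2 * f2 := by ring
    calc κ * ∫ t in t₀..t₁, Real.sqrt (∫ x, (partialDeriv j (moved θ i j P (-Γ) t) x -
            Γ t * Q.onCircle (x j) * partialDeriv i (moved θ i j P (-Γ) t) x) ^ 2)
        = Real.sqrt ((κ * ∫ t in t₀..t₁, Real.sqrt (∫ x, (partialDeriv j (moved θ i j P (-Γ) t) x -
            Γ t * Q.onCircle (x j) * partialDeriv i (moved θ i j P (-Γ) t) x) ^ 2)) ^ 2) := (Real.sqrt_sq hkI0).symm
      _ ≤ Real.sqrt (κ * (t₁ - t₀) / 2 * f2) := Real.sqrt_le_sqrt hsq2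
      _ = Real.sqrt (κ * (t₁ - t₀) / 2) * nf := by rw [Real.sqrt_mul (by positivity), hnf]
  -- (b5) `2κ ∫ A`
  have hb5 : 2 * κ * ∫ t in t₀..t₁, (C₂ * Real.sqrt (∫ x, moved θ i j P (-Γ) t x ^ 2) +
      2 * C₁ * Real.sqrt (∫ x, (partialDeriv j (moved θ i j P (-Γ) t) x -
        Γ t * Q.onCircle (x j) * partialDeriv i (moved θ i j P (-Γ) t) x) ^ 2)) ≤
      (2 * κ * (t₁ - t₀) * C₂ + 4 * C₁ * Real.sqrt (κ * (t₁ - t₀) / 2)) * nf := by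
    have iA1 : IntervalIntegrable (fun t => C₂ * Real.sqrt (∫ x, moved θ i j P (-Γ) t x ^ 2)) volume t₀ t₁ :=
      hII (continuousOn_const.mul (Real.continuous_sqrt.comp_continuousOn hNGc))
    have iA2 : IntervalIntegrable (fun t => 2 * C₁ * Real.sqrt (∫ x, (partialDeriv j (moved θ i j P (-Γ) t) x -
        Γ t * Q.onCircle (x j) * partialDeriv i (moved θ i j P (-Γ) t) x) ^ 2)) volume t₀ t₁ :=
      hII (continuousOn_const.mul (Real.continuous_sqrt.comp_continuousOn hNdc))
    rw [intervalIntegral.integral_add iA1 iA2, intervalIntegral.integral_const_mul, intervalIntegral.integral_const_mul]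
    have e1 := mul_le_mul_of_nonneg_left hb3 (by positivity : 0 ≤ 2 * κ * C₂)
    have e2 := mul_le_mul_of_nonneg_left hb4 (by positivity : 0 ≤ 4 * C₁)
    generalize (∫ t in t₀..t₁, Real.sqrt (∫ x, moved θ i j P (-Γ) t x ^ 2)) = IG at e1 ⊢
    generalize (∫ t in t₀..t₁, Real.sqrt (∫ x, (partialDeriv j (moved θ i j P (-Γ) t) x -
        Γ t * Q.onCircle (x j) * partialDeriv i (moved θ i j P (-Γ) t) x) ^ 2)) = ID at e2 ⊢
    generalize Real.sqrt (κ * (t₁ - t₀) / 2) = s at e2 ⊢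
    linarith
  -- (b6) `2κ ∫ R`
  have hb6 : 2 * κ * ∫ t in t₀..t₁, γ * ε₁ * (5 * (∫ x, partialDeriv i (moved θ i j P (-Γ) t) x ^ 2) +
      3 * (∫ x, (partialDeriv j (moved θ i j P (-Γ) t) x -
        Γ t * Q.onCircle (x j) * partialDeriv i (moved θ i j P (-Γ) t) x) ^ 2) +
      3 * C₁ ^ 2 * ∫ x, moved θ i j P (-Γ) t x ^ 2) ≤ γ * ε₁ * (5 + 6 * C₁ ^ 2 * κ * (t₁ - t₀)) * f2 := by
    have hmono : ∫ t in t₀..t₁, γ * ε₁ * (5 * (∫ x, partialDeriv i (moved θ i j P (-Γ) t) x ^ 2) +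
        3 * (∫ x, (partialDeriv j (moved θ i j P (-Γ) t) x -
          Γ t * Q.onCircle (x j) * partialDeriv i (moved θ i j P (-Γ) t) x) ^ 2) +
        3 * C₁ ^ 2 * ∫ x, moved θ i j P (-Γ) t x ^ 2) ≤
        ∫ t in t₀..t₁, γ * ε₁ * (5 * ((∫ x, partialDeriv i (moved θ i j P (-Γ) t) x ^ 2) +
          ∫ x, (partialDeriv j (moved θ i j P (-Γ) t) x -
            Γ t * Q.onCircle (x j) * partialDeriv i (moved θ i j P (-Γ) t) x) ^ 2) + 3 * C₁ ^ 2 * f2) := by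
      have iR2 : IntervalIntegrable (fun t => γ * ε₁ * (5 * ((∫ x, partialDeriv i (moved θ i j P (-Γ) t) x ^ 2) +
          ∫ x, (partialDeriv j (moved θ i j P (-Γ) t) x -
            Γ t * Q.onCircle (x j) * partialDeriv i (moved θ i j P (-Γ) t) x) ^ 2) + 3 * C₁ ^ 2 * f2))
          volume t₀ t₁ :=
        hII (continuousOn_const.mul ((continuousOn_const.mul (hNic.add hNdc)).add continuousOn_const))
      refine intervalIntegral.integral_mono_on ht.le (hII hRc) iR2 fun t htI => ?_
      refine mul_le_mul_of_nonneg_left ?_ (mul_nonneg hγ0 hε₁)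
      have h1 := mul_le_mul_of_nonneg_left (hNGle t htI) (sq_nonneg C₁)
      have h2 : 0 ≤ ∫ x, (partialDeriv j (moved θ i j P (-Γ) t) x -
          Γ t * Q.onCircle (x j) * partialDeriv i (moved θ i j P (-Γ) t) x) ^ 2 :=
        integral_nonneg fun x => sq_nonneg _
      linarith
    have hlin : ∫ t in t₀..t₁, γ * ε₁ * (5 * ((∫ x, partialDeriv i (moved θ i j P (-Γ) t) x ^ 2) +
          ∫ x, (partialDeriv j (moved θ i j P (-Γ) t) x -
            Γ t * Q.onCircle (x j) * partialDeriv i (moved θ i j P (-Γ) t) x) ^ 2) + 3 * C₁ ^ 2 * f2) =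
        γ * ε₁ * (5 * (∫ t in t₀..t₁, ((∫ x, partialDeriv i (moved θ i j P (-Γ) t) x ^ 2) +
          ∫ x, (partialDeriv j (moved θ i j P (-Γ) t) x -
            Γ t * Q.onCircle (x j) * partialDeriv i (moved θ i j P (-Γ) t) x) ^ 2)) +
          (t₁ - t₀) * (3 * C₁ ^ 2 * f2)) := by
      rw [intervalIntegral.integral_const_mul, intervalIntegral.integral_add (iNN.const_mul 5)
        (intervalIntegrable_const), intervalIntegral.integral_const_mul, intervalIntegral.integral_const,
        smul_eq_mul]
    have hstep := mul_le_mul_of_nonneg_left (hmono.trans_eq hlin) (by positivity : (0 : ℝ) ≤ 2 * κ)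
    refine hstep.trans ?_
    generalize (∫ t in t₀..t₁, ((∫ x, partialDeriv i (moved θ i j P (-Γ) t) x ^ 2) +
          ∫ x, (partialDeriv j (moved θ i j P (-Γ) t) x -
            Γ t * Q.onCircle (x j) * partialDeriv i (moved θ i j P (-Γ) t) x) ^ 2)) = J at hEn' ⊢
    have hγε0 : 0 ≤ γ * ε₁ := mul_nonneg hγ0 hε₁
    have h10 : γ * ε₁ * (10 * (κ * J)) ≤ γ * ε₁ * (10 * (f2 / 2)) :=
      mul_le_mul_of_nonneg_left (mul_le_mul_of_nonneg_left hEn' (by norm_num)) hγε0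
    nlinarith [h10, hγε0, sq_nonneg C₁, hκ, hτ0, hf20]
  have hb6' : Real.sqrt (2 * κ * ∫ t in t₀..t₁, γ * ε₁ * (5 * (∫ x, partialDeriv i (moved θ i j P (-Γ) t) x ^ 2) +
      3 * (∫ x, (partialDeriv j (moved θ i j P (-Γ) t) x -
        Γ t * Q.onCircle (x j) * partialDeriv i (moved θ i j P (-Γ) t) x) ^ 2) +
      3 * C₁ ^ 2 * ∫ x, moved θ i j P (-Γ) t x ^ 2)) ≤ Real.sqrt (γ * ε₁ * (5 + 6 * C₁ ^ 2 * κ * (t₁ - t₀))) * nf := by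
    rw [hnf, ← Real.sqrt_mul (by positivity)]
    exact Real.sqrt_le_sqrt hb6
  -- Step 6: assemble
  refine hmain.trans ?_
  generalize (2 * κ * ∫ t in t₀..t₁, (C₂ * Real.sqrt (∫ x, moved θ i j P (-Γ) t x ^ 2) +
      2 * C₁ * Real.sqrt (∫ x, (partialDeriv j (moved θ i j P (-Γ) t) x -
        Γ t * Q.onCircle (x j) * partialDeriv i (moved θ i j P (-Γ) t) x) ^ 2))) = IA at hb5 ⊢
  generalize Real.sqrt (2 * κ * ∫ t in t₀..t₁, γ * ε₁ * (5 * (∫ x, partialDeriv i (moved θ i j P (-Γ) t) x ^ 2) +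
      3 * (∫ x, (partialDeriv j (moved θ i j P (-Γ) t) x -
        Γ t * Q.onCircle (x j) * partialDeriv i (moved θ i j P (-Γ) t) x) ^ 2) +
      3 * C₁ ^ 2 * ∫ x, moved θ i j P (-Γ) t x ^ 2)) = IR at hb6' ⊢
  linarith


end Main

end Summit.AnomalousDissipation.AnomalousDissipation.Theorems.SawtoothPulseCascade.K1Slot
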